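import Summits.BirchSwinnertonDyer.BirchSwinnertonDyer.Theorems.QuadraticBranchSignedControlPlusKatoDivisibilityOfKatoColeman
import Summits.BirchSwinnertonDyer.BirchSwinnertonDyer.Theorems.QuadraticBranchSignedControlPlusEtaLowerInclusionFouquetWanLocus
import Literature.NumberTheory.EllipticCurves.Kim2026.ShaLengthRankZeroLowerBound
import HarnessLib

/-!
# Route `QuadraticBranchSignedControl` (rung K8, cell `bsd-potss`), crux `PlusEtaLowerInclusion`
# (item stmt-BirchSwinnertonDyer-19601): the KURIHARA ROAD — (E⁺_η) and (C1⁺_η) at a pair from ONE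
# unit Kurihara number of the additive partner `W`, RANK-FREE, HEIGHT-FREE, through Kato's main
# conjecture for `W` (Kim 2026 Thm. 1.11 (1) ⟹ (3)) and Kobayashi's `η`-package (a `--supports` file;
# seat `bsd-potss-k8eta-c1`, gen 6)

WHAT. Crux 19601 is Kobayashi's Eisenstein inclusion `Char(X⁺(V/K_∞)^η) ⊆ (L_p⁺(V, η, X))` at the
quadratic `η = ω^{(p−1)/2}` for every tower-onto good supersingular `a_p(V) = 0` twist `V`, `p ≥ 5` —
by the proof of Kobayashi's Thm. 7.4 the `η`-component of the lower half of Kato's main conjecture for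
`T_pV`, i.e. Kato's lower inclusion for the ADDITIVE partner `W = V ⊗ χ_{p*}` over `ℚ_∞` (open class-wide
for every non-CM `V`). The cell's earlier roads reach the crux PAIR BY PAIR from the lower `p`-part of
`BSD(W)`: rank `0` by Kurihara numbers through Kim's Thm. 1.8 (6) + converse control (gens 0–2, 5),
rank `1` by the λ-squeeze / the Tamagawa and Mordell–Weil roads (gens 3–5) — every one of them is a
LEVEL-ZERO instrument (the constant term resp. the first Taylor coefficient at `T = 0`), which is why the
three rank-one rows whose analytic defect sits in the cyclotomic height (`232050cw1`, `418950b1`,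
`69150v1`) were out of reach (gen 5 memo §C). THIS FILE takes the OTHER printed road, which does not
pass through `T = 0` at all: C.-H. Kim, Amer. J. Math. 148 (2026) **Thm. 1.11 (1) ⟹ (3)** — for `E/ℚ`,
`p ≥ 5`, `ρ̄` onto, Manin constant prime to `p`, `E(ℚ_p)[p] = 0`, all Tamagawa factors prime to `p`: ONE
Kurihara number `δ̃_n ≢ 0 (mod p)` (`n ∈ 𝒩₁`) implies Kato's main conjecture `char(H¹_Iw/Λκ₁^{Kato,∞}) =
char(Sel₀(ℚ_∞, E[p^∞])^∨)` in FULL (Λ-primitivity of Kato's Kolyvagin system, Büyükboduk + Mazur–Rubin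
5.3.10), with NO hypothesis on the reduction at `p` — applied to `E := W` (additive at `p`) and read on
the pinned objects of Kobayashi's `η`-package (named fact
`Kim2026.thm111_etaEisensteinInclusion_of_kuriharaNumber_ne_zero`, proposal p534181, file
`Literature/…/Kim2026/EtaKatoMainConjectureOfUnitKuriharaNumber.lean`; here its BODY is the displayed
hypothesis `hKim` of §3, so this file does not depend on that proposal); then the four-term `η`-sequence
`0 → 𝐇¹/Λz → Λ/(Col⁺ z) → X⁺(V/K_∞)^η → X⁰ → 0` of the package (Kobayashi (7.21) + Thm. 6.2/6.3 at `η`)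
and the characteristic-ideal bookkeeping of the proof of Thm. 7.4 (tree `Thm74Skeleton.*`, k8q-c3) turn
the Eisenstein half `Char X⁰ ⊆ Char(𝐇¹/Λz)` into (E⁺_η), and together with Kato's bound (package field
`kato_integral`, under the onto tower) into the full even main conjecture (C1⁺_η) at `η`.

* §1 `plusEtaLowerInclusionAt_of_etaEisensteinFrame` — (E⁺_η) `QuadraticBranchPlusEtaLowerInclusionAt V p`
  from the displayed PER-PAIR frame `hE`: for every `η`-frame and every pinned `I`, `FB` of the partner
  `W` a package datum whose zeta line satisfies `Char X⁰ ⊆ Char(𝐇¹/Λz)`. Pure module theory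
  (`charIdeal_le_span_singleton_of_fourTermExact`); no tower hypothesis, no rank, no height, no Tamagawa.
* §2 `plusEtaMainConjectureAt_of_etaEisensteinFrame_of_surjective` — (C1⁺_η) from the same frame AND the
  onto tower (`kato_integral` gives the other inclusion; `charIdeal_eq_span_singleton_iff_of_fourTermExact`).
* §3 THE ROAD `etaPair_of_kimThm111Frame_of_kuriharaUnit`: from `hKim` (the fact's body, displayed) and
  the per-row data of ONE partner `W` — `ρ̄_{W,p}` onto, `#W(ℚ_p)[p] = 1`, `p ∤ ∏ c_ℓ(W)`, a modular
  parametrisation datum with `p ∤ c_D` and the period transfer, a level `n ∈ 𝒩₁` with the cyclicity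
  flag, and the certificate `kuriharaNumber D.f p n ψ ≠ 0` — (E⁺_η) at `(V, p)`, and (C1⁺_η) under the
  onto tower. CONSEQUENCE for the census (evidence kit j279367, this seat, `--workitem 19601`; engine E =
  eclib exact modular symbols; pre-registered predictions P1–P4 all met — in particular EVERY ν = 1
  Kurihara number of the three Tamagawa control rows vanishes mod 5, as Kim's Remark 6.2 predicts, while
  the Tamagawa-free rows show units): the two Tamagawa-free rank-one residue rows carry unit Kurihara
  numbers (`232050cw1`: `δ̃_41, δ̃_181, …`; `418950b1`: `δ̃_601, δ̃_761, …`), so their records (sibling file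
  `…PlusEtaR1KuriharaRows01.lean`) instantiate this road; `69150v1` (`5 ∣ c₂, c₃`) is out of its scope.
* §4 READING for the planner: on the sub-locus «partner `W` Tamagawa-`p`-free, Manin prime to `p`» of the
  tower-onto Gss2 pairs, the crux 19601 FOLLOWS (modulo `hKim` + the package) from the existence of ONE
  unit Kurihara number of `W` — Kim's Conjecture 1.9 (non-vanishing of `δ̃` mod `p`), a Σ₁ statement per
  pair, decidable by a finite modular-symbol computation whenever true
  (`plusEtaLowerInclusionAt_iff_nonempty_frame_remark` is NOT claimed; only the displayed direction).

HONEST FRAMING (cell `bsd-potss`, HOME run/shared/lean/pub/bsd-potss/; FULL-BSD rank ≤ 1 programme,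
HUMAN RULING D-0036/D-0074/D-0088): TOOL THEOREMS ONLY — no definition, no named fact minted here, no
`sorry`, axioms standard. Everything is CONDITIONAL: §1–§2 on the displayed per-pair frame, §3 on `hKim`
(a PUBLISHED theorem read at `η` through the flagged zeta-line identification `Kim26-111-eta-zeta-line`
— see the Literature file's module docstring) and on displayed per-row inputs; the class-wide crux 19601,
its parent 19242 and the route are NOT closed; nothing is booked; `BSD(W, p)` is claimed for no pair;
BSD is not proved by any of this. Seat `bsd-potss-k8eta-c1` (prover-bsd-potss-k8eta-c1-g6-0), gen 6;
`--supports stmt-BirchSwinnertonDyer-19601`.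

References: [Kim2022StructureSelmer] Thm. 1.11 (PDF p. 8) and its proof §6 (PDF p. 31), Conj. 1.3
(PDF p. 5), Remark 6.2; [Kobayashi2003] §4 (p. 8), §5 (p. 10), Thm. 6.2/6.3 (p. 11), (7.21), Cor. 7.2 and
the proof of Thm. 7.4 (p. 13); [Kato2004Asterisque] Thm. 12.5, Conj. 12.10; [MazurRubin2004] Thm. 5.3.10;
[NeukirchSchmidtWingberg2008] Ch. V §3 (characteristic ideals); [Rohrlich1984] (non-vanishing of twists).
-/

set_option autoImplicit false
-- single-problem summit: the namespace `Summit.BirchSwinnertonDyer.BirchSwinnertonDyer.…` repeats a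
-- component by design (D-0017 layout), which `linter.dupNamespace` would flag on every declaration
set_option linter.dupNamespace false

noncomputable section

open scoped Classical

open CongruenceSubgroup Field WeierstrassCurve
open Literature.NumberTheory.EllipticCurves
open Literature.NumberTheory.EllipticCurves.ModularForms
open Literature.NumberTheory.GaloisRepresentations
open Summit.BirchSwinnertonDyer.Rank1Residual.Additive hiding EtaSignedSelmerDualData
  IsQuadraticBranchPlusLFunction IsQuadraticBranchMinusLFunction
open Summit.BirchSwinnertonDyer.BirchSwinnertonDyer.Theses.QuadraticBranchSignedControl

namespace Summit.BirchSwinnertonDyer.BirchSwinnertonDyer.Theorems.KuriharaRoad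

/-! ## §1 (E⁺_η) from the per-pair Eisenstein frame on the `η`-package -/

section Frame

variable {V : WeierstrassCurve ℚ} [V.IsElliptic] [V.IsGloballyMinimal] {p : ℕ} [Fact p.Prime]
  (W : WeierstrassCurve ℚ) [W.IsElliptic] [ContinuousSMul ℤ_[p] (W.tateModule p)]

/-- **(E⁺_η) `QuadraticBranchPlusEtaLowerInclusionAt V p` from the displayed per-pair EISENSTEIN FRAME
`hE`**: a curve `W/ℚ` (intended: a model of the partner `V^{(p*)}`; the algebra below uses only the
frame stated on `W`'s pinned objects, not the twist relation) such that for every `η`-frame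
(`K₀ = ℚ(μ_p)`, THE quadratic `ηq`, newform `f` of `V`, period ratio `ϖ`, cyclotomic `κ`, generator `γ`)
and every pinned `I : Kato2004.IwasawaH1Data W p κ γ` («`H¹_Iw(ℚ, T_pW) = 𝐇¹(T_pV)^η`»),
`FB : W.FineSelmerDualData κ γ` («`X⁰(W/ℚ_∞) = X⁰(V/K_∞)^η`») there is a package datum
`d : Kobayashi2003.EtaKatoColemanPoitouTateData …` (Kobayashi Thm. 5.2/6.2/6.3/7.3 i)/Cor. 7.2 at `η`) whose
zeta line satisfies the Eisenstein half of Kato's main conjecture, `Char_Λ(FB.X) ⊆ Char_Λ(I.H ⧸ Λ∙d.z)`.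
Proof (Kobayashi, proof of Thm. 7.4, p. 13, direction Kato ⟹ even, Eisenstein halves): pin `I`, `FB`
(`Kato2004.nonempty_iwasawaH1Data_holds`, `nonempty_fineSelmerDualData`); from `d.exact_plus` and the
injective `Col⁺∘loc` the sequence `0 → 𝐇¹/Λz → Λ/(Col⁺ z) → X(D) → X⁰ → 0`
(`Thm74Skeleton.exists_fourTermExact_of_threeTermExact`); `Col⁺ z ≠ 0` (Rohrlich,
`IsQuadraticBranchPlusLFunction.ne_zero_of_isNewformOf`) and `(Lη) = (Col⁺ z)` for every plus function
`Lη` (`….span_singleton_eq`); then `char X⁰ ⊆ char(𝐇¹/Λz)` gives `Char X(D) ⊆ (Col⁺ z) = (Lη)`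
(`Thm74Skeleton.charIdeal_le_span_singleton_of_fourTermExact`). No tower / rank / height / Tamagawa
hypothesis. CONDITIONAL on `hE`; closes nothing.
[cite: Kobayashi2003, proof of Thm. 7.4 (p. 13), §4 (p. 8), Thm. 6.3 (p. 11)]
[cite: NeukirchSchmidtWingberg2008, Ch. V §3] -/
theorem plusEtaLowerInclusionAt_of_etaEisensteinFrame
    (hE : ∀ (K₀ : Type) [Field K₀] [NumberField K₀] [IsCyclotomicExtension {p} ℚ K₀]
        [(galRange (K := ℚ) K₀).Normal] (ηq : absoluteGaloisGroup ℚ →* ℤˣ),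
        (∀ σ ∈ galRange (K := ℚ) K₀, ηq σ = 1) → ηq ≠ 1 →
      ∀ {N : ℕ} [NeZero N] {f : CuspForm (Gamma0 N) 2},
        p ≠ 2 → V.HasGoodReductionAtPrime p → V.frobeniusTrace p = 0 → IsNewformOf V f →
      ∀ (ϖ : ℚ), (if Even (p / 2) then (ϖ : ℝ) * V.realPeriodRat = plusPeriod f
          else (ϖ : ℝ) * V.imaginaryPeriodRat = minusPeriod f) →
      ∀ (κ : ZpExtension ℚ p) (γ : absoluteGaloisGroup ℚ),
        κ.IsCyclotomic → κ.IsTopGenerator γ → γ ∈ galRange (K := ℚ) K₀ → IsCyclotomicVariable p γ →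
      ∀ (I : Kato2004.IwasawaH1Data W p κ γ) (FB : W.FineSelmerDualData κ γ),
        ∃ d : Kobayashi2003.EtaKatoColemanPoitouTateData p K₀ ηq V f ϖ κ γ W I FB,
          Module.charIdeal (IwasawaAlgebra p) FB.X ≤
            Module.charIdeal (IwasawaAlgebra p)
              (I.H ⧸ Submodule.span (IwasawaAlgebra p) {d.z})) :
    QuadraticBranchPlusEtaLowerInclusionAt V p := by
  intro K₀ _ _ _ _ ηq hηK hη1 N _ f hp2 hgood hap hf ϖ hϖ Lη hL κ γ hκ hγ hγK hγc D
  -- pin `𝐇¹_Γ(T_pW)` and `X⁰(W/ℚ_∞)`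
  obtain ⟨I⟩ := Kato2004.nonempty_iwasawaH1Data_holds W p κ γ hκ hγ
  obtain ⟨FB⟩ := W.nonempty_fineSelmerDualData κ hγ
  haveI : Module.Finite (IwasawaAlgebra p) FB.X :=
    WeierstrassCurve.FineSelmerDualData.module_finite _ κ hγ FB
  obtain ⟨d, hEis⟩ := hE K₀ ηq hηK hη1 hp2 hgood hap hf ϖ hϖ κ γ hκ hγ hγK hγc I FB
  -- (7.21) at `η` for the Literature copy of `D`, then the four-term sequence
  obtain ⟨j, k, hcj, hjk, hk⟩ := d.exact_plus D.toLiterature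
  obtain ⟨i, j', k', hi, hij, hjk', hk'⟩ :=
    Thm74Skeleton.exists_fourTermExact_of_threeTermExact d.colPlus j k d.colPlus_injective hcj hjk hk
      d.z
  -- `Col⁺ z ≠ 0` (Rohrlich) and `(Lη) = (Col⁺ z)`
  have hϖ0 : ϖ ≠ 0 := by
    rintro rfl
    rw [Rat.cast_zero, zero_mul, zero_mul] at hϖ
    by_cases h2 : Even (p / 2)
    · rw [if_pos h2] at hϖ
      exact (IsNewform0.plusPeriod_pos_holds hf.1 hf.coeffField_eq_bot).ne hϖ
    · rw [if_neg h2] at hϖ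
      exact (IsNewform0.minusPeriod_pos_holds hf.1 hf.coeffField_eq_bot).ne hϖ
  have hL0 : d.colPlus d.z ≠ 0 :=
    Summit.BirchSwinnertonDyer.Rank1Residual.Additive.IsQuadraticBranchPlusLFunction.ne_zero_of_isNewformOf
      hp2 hf hgood hϖ0 d.isPlus_colPlus_z
  have hspan : Ideal.span ({Lη} : Set (IwasawaAlgebra p)) = Ideal.span {d.colPlus d.z} :=
    Summit.BirchSwinnertonDyer.Rank1Residual.Additive.IsQuadraticBranchPlusLFunction.span_singleton_eq
      hp2 hL d.isPlus_colPlus_z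
  -- the Eisenstein half projects to `Char X(D) ⊆ (Col⁺ z)`
  have hle := Thm74Skeleton.charIdeal_le_span_singleton_of_fourTermExact d.isTorsion_fine hL0
    i j' k' hi hij hjk' hk' hEis
  rw [← EtaSignedSelmerDualData.charIdeal_toLiterature, hspan]
  exact hle

/-! ## §2 (C1⁺_η) from the same frame and the onto `p`-adic tower -/

/-- **(C1⁺_η) `QuadraticBranchPlusEtaMainConjectureAt V p` from the per-pair Eisenstein frame AND the
onto `p`-adic tower of `V`**: the package field `kato_integral` (Kobayashi Thm. 5.2 v) = Kato Thm. 12.5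
under `ρ_{V,p^∞}` onto) gives `Char(𝐇¹/Λz) ⊆ Char X⁰`, the frame gives `⊇`, so `Char(𝐇¹/Λz) = Char X⁰`
and along the four-term sequence `Char X(D) = (Col⁺ z) = (Lη)`
(`Thm74Skeleton.charIdeal_eq_span_singleton_iff_of_fourTermExact`); finite generation and torsion of
`X(D)` along `Λ/(Col⁺ z) → X(D) → X⁰ → 0` (Thm. 2.2 at `η`, Kobayashi's Thm. 7.3 ii) argument).
CONDITIONAL on `hE`; closes nothing. [cite: Kobayashi2003, proof of Thm. 7.4 (p. 13), §4 (p. 8), Thm. 5.2 v) (p. 9), Thm. 7.3 ii) (p. 13)]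
[cite: NeukirchSchmidtWingberg2008, Ch. V §3] -/
theorem plusEtaMainConjectureAt_of_etaEisensteinFrame_of_surjective
    (hE : ∀ (K₀ : Type) [Field K₀] [NumberField K₀] [IsCyclotomicExtension {p} ℚ K₀]
        [(galRange (K := ℚ) K₀).Normal] (ηq : absoluteGaloisGroup ℚ →* ℤˣ),
        (∀ σ ∈ galRange (K := ℚ) K₀, ηq σ = 1) → ηq ≠ 1 →
      ∀ {N : ℕ} [NeZero N] {f : CuspForm (Gamma0 N) 2},
        p ≠ 2 → V.HasGoodReductionAtPrime p → V.frobeniusTrace p = 0 → IsNewformOf V f →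
      ∀ (ϖ : ℚ), (if Even (p / 2) then (ϖ : ℝ) * V.realPeriodRat = plusPeriod f
          else (ϖ : ℝ) * V.imaginaryPeriodRat = minusPeriod f) →
      ∀ (κ : ZpExtension ℚ p) (γ : absoluteGaloisGroup ℚ),
        κ.IsCyclotomic → κ.IsTopGenerator γ → γ ∈ galRange (K := ℚ) K₀ → IsCyclotomicVariable p γ →
      ∀ (I : Kato2004.IwasawaH1Data W p κ γ) (FB : W.FineSelmerDualData κ γ),
        ∃ d : Kobayashi2003.EtaKatoColemanPoitouTateData p K₀ ηq V f ϖ κ γ W I FB,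
          Module.charIdeal (IwasawaAlgebra p) FB.X ≤
            Module.charIdeal (IwasawaAlgebra p)
              (I.H ⧸ Submodule.span (IwasawaAlgebra p) {d.z}))
    (hs : ∀ m : ℕ, V.HasSurjectiveModNGaloisRep (p ^ m : ℕ)) :
    QuadraticBranchPlusEtaMainConjectureAt V p := by
  intro K₀ _ _ _ _ ηq hηK hη1 N _ f hp2 hgood hap hf ϖ hϖ Lη hL κ γ hκ hγ hγK hγc D
  obtain ⟨I⟩ := Kato2004.nonempty_iwasawaH1Data_holds W p κ γ hκ hγ
  obtain ⟨FB⟩ := W.nonempty_fineSelmerDualData κ hγ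
  haveI : Module.Finite (IwasawaAlgebra p) FB.X :=
    WeierstrassCurve.FineSelmerDualData.module_finite _ κ hγ FB
  obtain ⟨d, hEis⟩ := hE K₀ ηq hηK hη1 hp2 hgood hap hf ϖ hϖ κ γ hκ hγ hγK hγc I FB
  obtain ⟨j, k, hcj, hjk, hk⟩ := d.exact_plus D.toLiterature
  obtain ⟨i, j', k', hi, hij, hjk', hk'⟩ :=
    Thm74Skeleton.exists_fourTermExact_of_threeTermExact d.colPlus j k d.colPlus_injective hcj hjk hk
      d.z
  have hϖ0 : ϖ ≠ 0 := by
    rintro rfl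
    rw [Rat.cast_zero, zero_mul, zero_mul] at hϖ
    by_cases h2 : Even (p / 2)
    · rw [if_pos h2] at hϖ
      exact (IsNewform0.plusPeriod_pos_holds hf.1 hf.coeffField_eq_bot).ne hϖ
    · rw [if_neg h2] at hϖ
      exact (IsNewform0.minusPeriod_pos_holds hf.1 hf.coeffField_eq_bot).ne hϖ
  have hL0 : d.colPlus d.z ≠ 0 :=
    Summit.BirchSwinnertonDyer.Rank1Residual.Additive.IsQuadraticBranchPlusLFunction.ne_zero_of_isNewformOf
      hp2 hf hgood hϖ0 d.isPlus_colPlus_z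
  have hspan : Ideal.span ({Lη} : Set (IwasawaAlgebra p)) = Ideal.span {d.colPlus d.z} :=
    Summit.BirchSwinnertonDyer.Rank1Residual.Additive.IsQuadraticBranchPlusLFunction.span_singleton_eq
      hp2 hL d.isPlus_colPlus_z
  -- finite generation and torsion of `X(D)` (Thm. 2.2 at `η` on this frame)
  have hfin : Module.Finite (IwasawaAlgebra p) D.toLiterature.X := Module.Finite.of_exact hjk' hk'
  have htor : Module.IsTorsion (IwasawaAlgebra p) D.toLiterature.X :=
    Thm74Skeleton.isTorsion_of_exact (Thm74Skeleton.isTorsion_quotient_span_singleton hL0)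
      d.isTorsion_fine j' k' hjk'
  -- Kato's bound + the Eisenstein half = equality of the two characteristic ideals
  have hAB : Module.charIdeal (IwasawaAlgebra p)
        (I.H ⧸ Submodule.span (IwasawaAlgebra p) {d.z}) =
      Module.charIdeal (IwasawaAlgebra p) FB.X :=
    le_antisymm (d.kato_integral hs) hEis
  have hchar := (Thm74Skeleton.charIdeal_eq_span_singleton_iff_of_fourTermExact d.isTorsion_fine hL0
    i j' k' hi hij hjk' hk').mpr hAB
  refine ⟨hfin, htor, ?_⟩
  rw [← EtaSignedSelmerDualData.charIdeal_toLiterature, hspan]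
  exact hchar

end Frame

/-! ## §3 The road: ONE unit Kurihara number of the partner `W` ⟹ (E⁺_η), and (C1⁺_η) under the tower -/

section Road

variable {V : WeierstrassCurve ℚ} [V.IsElliptic] [V.IsGloballyMinimal] {p : ℕ} [Fact p.Prime]

/-- **THE KURIHARA ROAD to (E⁺_η) ∧ (C1⁺_η) at a pair, RANK-FREE** (Kim 2026 Thm. 1.11 (1) ⟹ (3) at
`η` + Kobayashi's `η`-package + the proof of Thm. 7.4). Displayed hypothesis `hKim` = VERBATIM the body
of the named fact `Kim2026.thm111_etaEisensteinInclusion_of_kuriharaNumber_ne_zero` (proposal p534181;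
a PUBLISHED theorem — C.-H. Kim, Amer. J. Math. 148 (2026) Thm. 1.11 — read at `η` through the flagged
zeta-line identification; see that file): for the `η`-frame, a GLOBALLY MINIMAL partner `W` of `V`
(`C • W^{(p*)} = V`) with `5 ≤ p`, `ρ̄_{W,p}` onto, `#W(ℚ_p)[p] = 1`, `p ∤ ∏ c_ℓ(W)`, a modular
parametrisation datum `D` with `p ∤ c_D` and the period transfer, a level `n ∈ 𝒩₁` with the cyclicity
flag and a unit Kurihara number `kuriharaNumber D.f p n ψ ≠ 0` ⟹ the Eisenstein half of Kato's main
conjecture on the package. Per-row inputs in hypothesis position: exactly those binders for ONE partner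
`W` (`hsurj`, `ht0`, `htam`, `D`, `hc`, `hper`, `n`, `hn`, `hcyc`, `ψ`, `hψ`, `hδ`). CONCLUSION:
(E⁺_η) `QuadraticBranchPlusEtaLowerInclusionAt V p` (§1), and (C1⁺_η)
`QuadraticBranchPlusEtaMainConjectureAt V p` granted the onto tower of `V` (§2). No rank hypothesis, no
height, no Tamagawa road, no `L`-value certificate: the single certificate is the Kurihara number.
CONDITIONAL on `hKim` and the displayed inputs; closes nothing; silent when `p ∣ ∏ c_ℓ(W)` (no unit
Kurihara number exists there, Kim Remark 6.2). [cite: Kim2022StructureSelmer, Thm. 1.11 (PDF p. 8), proof §6 (PDF p. 31), Remark 6.2]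
[cite: Kobayashi2003, proof of Thm. 7.4 (p. 13), §4 (p. 8), §5 (p. 10)] [cite: MazurRubin2004, Thm. 5.3.10] -/
theorem etaPair_of_kimThm111Frame_of_kuriharaUnit
    (hKim : ∀ (p : ℕ) [Fact p.Prime] (K₀ : Type) [Field K₀] [NumberField K₀]
        [IsCyclotomicExtension {p} ℚ K₀] [(galRange (K := ℚ) K₀).Normal]
        (η : absoluteGaloisGroup ℚ →* ℤˣ), (∀ σ ∈ galRange (K := ℚ) K₀, η σ = 1) → η ≠ 1 →
      ∀ (V : WeierstrassCurve ℚ) [V.IsElliptic] [V.IsGloballyMinimal] {N : ℕ} [NeZero N]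
        {f : CuspForm (Gamma0 N) 2},
        p ≠ 2 → V.HasGoodReductionAtPrime p → V.frobeniusTrace p = 0 → IsNewformOf V f →
      ∀ (ϖ : ℚ), (if Even (p / 2) then (ϖ : ℝ) * V.realPeriodRat = plusPeriod f
          else (ϖ : ℝ) * V.imaginaryPeriodRat = minusPeriod f) →
      ∀ (κ : ZpExtension ℚ p) (γ : absoluteGaloisGroup ℚ),
        κ.IsCyclotomic → κ.IsTopGenerator γ → γ ∈ galRange (K := ℚ) K₀ → IsCyclotomicVariable p γ →
      ∀ (W : WeierstrassCurve ℚ) [W.IsElliptic] [W.IsGloballyMinimal]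
        [ContinuousSMul ℤ_[p] (W.tateModule p)]
        (C : VariableChange ℚ), C • W.quadraticTwist ((-1) ^ (p / 2) * p) = V →
        5 ≤ p → W.HasSurjectiveModNGaloisRep p →
        Nat.card {Q : (W.baseChange ℚ_[p]).toAffine.Point // (p : ℕ) • Q = 0} = 1 →
        ¬ p ∣ W.tamagawaProduct →
      ∀ {NW : ℕ} [NeZero NW] (D : ModularParametrizationData W NW),
        ¬ (p : ℤ) ∣ D.maninConstant →
        (∃ u : ℚ, ‖(u : ℚ_[p])‖ = 1 ∧ W.realPeriodRat = u * plusPeriod D.f) →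
      ∀ (n : ℕ) [NeZero n], Kato.IsKolyvaginProduct W p 1 n →
        (∀ (ℓ : ℕ) [Fact ℓ.Prime], ℓ ∣ n →
          Nat.card {P : ((WeierstrassCurve.integralModelInt W).map
              (Int.castRingHom (ZMod ℓ))).toAffine.Point // p • P = 0} ≤ p) →
      ∀ ψ : (ℓ : ℕ) → (ZMod ℓ)ˣ →* Multiplicative (ZMod p),
        (∀ ℓ ∈ n.primeFactors, Function.Surjective (ψ ℓ)) →
        kuriharaNumber D.f p n ψ ≠ 0 →
      ∀ (I : Kato2004.IwasawaH1Data W p κ γ) (FB : W.FineSelmerDualData κ γ),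
        ∃ d : Kobayashi2003.EtaKatoColemanPoitouTateData p K₀ η V f ϖ κ γ W I FB,
          Module.charIdeal (IwasawaAlgebra p) FB.X ≤
            Module.charIdeal (IwasawaAlgebra p) (I.H ⧸ Submodule.span (IwasawaAlgebra p) {d.z}))
    (W : WeierstrassCurve ℚ) [W.IsElliptic] [W.IsGloballyMinimal] (C : VariableChange ℚ)
    (hCV : C • W.quadraticTwist ((-1) ^ (p / 2) * p) = V) (h5 : 5 ≤ p)
    (hsurj : W.HasSurjectiveModNGaloisRep p)
    (ht0 : Nat.card {Q : (W.baseChange ℚ_[p]).toAffine.Point // (p : ℕ) • Q = 0} = 1)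
    (htam : ¬ p ∣ W.tamagawaProduct)
    {NW : ℕ} [NeZero NW] (D : ModularParametrizationData W NW) (hc : ¬ (p : ℤ) ∣ D.maninConstant)
    (hper : ∃ u : ℚ, ‖(u : ℚ_[p])‖ = 1 ∧ W.realPeriodRat = u * plusPeriod D.f)
    (n : ℕ) [NeZero n] (hn : Kato.IsKolyvaginProduct W p 1 n)
    (hcyc : ∀ (ℓ : ℕ) [Fact ℓ.Prime], ℓ ∣ n →
      Nat.card {P : ((WeierstrassCurve.integralModelInt W).map
          (Int.castRingHom (ZMod ℓ))).toAffine.Point // p • P = 0} ≤ p)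
    (ψ : (ℓ : ℕ) → (ZMod ℓ)ˣ →* Multiplicative (ZMod p))
    (hψ : ∀ ℓ ∈ n.primeFactors, Function.Surjective (ψ ℓ)) (hδ : kuriharaNumber D.f p n ψ ≠ 0) :
    QuadraticBranchPlusEtaLowerInclusionAt V p ∧
      ((∀ m : ℕ, V.HasSurjectiveModNGaloisRep (p ^ m : ℕ)) →
        QuadraticBranchPlusEtaMainConjectureAt V p) := by
  haveI : ContinuousSMul ℤ_[p] (W.tateModule p) := TateModule.continuousSMul_padicInt
  have hE : ∀ (K₀ : Type) [Field K₀] [NumberField K₀] [IsCyclotomicExtension {p} ℚ K₀]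
        [(galRange (K := ℚ) K₀).Normal] (ηq : absoluteGaloisGroup ℚ →* ℤˣ),
        (∀ σ ∈ galRange (K := ℚ) K₀, ηq σ = 1) → ηq ≠ 1 →
      ∀ {N : ℕ} [NeZero N] {f : CuspForm (Gamma0 N) 2},
        p ≠ 2 → V.HasGoodReductionAtPrime p → V.frobeniusTrace p = 0 → IsNewformOf V f →
      ∀ (ϖ : ℚ), (if Even (p / 2) then (ϖ : ℝ) * V.realPeriodRat = plusPeriod f
          else (ϖ : ℝ) * V.imaginaryPeriodRat = minusPeriod f) →
      ∀ (κ : ZpExtension ℚ p) (γ : absoluteGaloisGroup ℚ),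
        κ.IsCyclotomic → κ.IsTopGenerator γ → γ ∈ galRange (K := ℚ) K₀ → IsCyclotomicVariable p γ →
      ∀ (I : Kato2004.IwasawaH1Data W p κ γ) (FB : W.FineSelmerDualData κ γ),
        ∃ d : Kobayashi2003.EtaKatoColemanPoitouTateData p K₀ ηq V f ϖ κ γ W I FB,
          Module.charIdeal (IwasawaAlgebra p) FB.X ≤
            Module.charIdeal (IwasawaAlgebra p)
              (I.H ⧸ Submodule.span (IwasawaAlgebra p) {d.z}) :=
    fun K₀ _ _ _ _ ηq hηK hη1 N _ f hp2 hgood hap hf ϖ hϖ κ γ hκ hγ hγK hγc I FB =>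
      hKim p K₀ ηq hηK hη1 V hp2 hgood hap hf ϖ hϖ κ γ hκ hγ hγK hγc W C hCV h5 hsurj ht0 htam D hc
        hper n hn hcyc ψ hψ hδ I FB
  exact ⟨plusEtaLowerInclusionAt_of_etaEisensteinFrame W hE,
    fun hs => plusEtaMainConjectureAt_of_etaEisensteinFrame_of_surjective W hE hs⟩

end Road

end Summit.BirchSwinnertonDyer.BirchSwinnertonDyer.Theorems.KuriharaRoad

end
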